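import Summits.HodgeConjecture.HodgeConjecture.Theorems.SixfoldTableXCensusWeilEndFieldRowsAllMembers
import Literature.AlgebraicGeometry.VanGeemen1994.WeilTypeEndFieldOfRankTwo
import HarnessLib

/-!
# TABLE X ROW 9 (`End⁰ = K` EXACTLY), EVERY MEMBER — the census with the displayed domain datum `¬ 𝒞 A` DISCHARGED from
# the row's own rank binder `finrank_ℚ End⁰(A) = 2` (cell `pub-hodgeav-hg6`, req-37 (A) Q2b; eng-3 g3)

HONEST FRAMING. HC, `HC_AV` (stmt-1333), `HC_CM` (stmt-3052) and H2 are NOT proved and do not occur. X2 ∕ X1 stay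
`@[conjecture]` (OURS). KERNEL ONLY: one-line theorems over existing declarations; no definition, no `sorry`, no named
fact; restates nothing.

`TableX.WeilLieRows.census_weilType_endK` (`SixfoldTableXCensusWeilEndFieldRowsAllMembers`, p698361) displays
`hdom : ¬ (IsOfCMType A ∨ ProdCMCell …)`; but `finrank_ℚ End⁰(A) = 2` with `φ² = −d` already makes `End⁰(A) = ℚ(φ)` a field,
so `A` is SIMPLE and NOT of CM type (`VanGeemen1994.isSimple_of_finrank_endAlgebra_eq_two`,
`not_isOfCMType_of_finrank_endAlgebra_eq_two`), hence off the residue class (`not_residueClass_of_isSimple_of_not_isOfCMType`).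
* `census_weilType_endK'` (+ `_of_isIsogenous`) — row 9, every member, binders `hW, hE2, hh, hnd, hφQ` ONLY.
All declarations in the sub-namespace `TableX.WeilLieRows`; typed ≠ proved.
-/

set_option linter.dupNamespace false

noncomputable section

open scoped TensorProduct
open CategoryTheory
open Literature.AlgebraicGeometry Literature.AlgebraicGeometry.Motives
open Literature.AlgebraicGeometry.Motives.AbelianVariety (IsIsogenous IsSimple)
open Literature.AlgebraicGeometry.Motives.HodgeStructure
open Literature.AlgebraicGeometry.HodgeTheory
open Literature.AlgebraicGeometry.Milne1999
open Literature.AlgebraicGeometry.VanGeemen1994 (pullbackOne hodgeGroupOne detOnEigenspace HasHodgeGroupSU hK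
  isSimple_of_finrank_endAlgebra_eq_two not_isOfCMType_of_finrank_endAlgebra_eq_two)
open Literature.AlgebraicTopology.SingularHomology
open Literature.Barriers.HodgeConjecture
open Summit.HodgeConjecture.HodgeConjecture.Ring2.ClassTargets
open Summit.HodgeConjecture.HodgeConjecture.Ring2.Motiv (ProdCMCell)
open Summit.HodgeConjecture.HodgeConjecture.Ring2.Atlas (IsQuarticFieldTypeIVFourfold)

namespace Summit.HodgeConjecture.HodgeConjecture.TableX.WeilLieRows

variable (A : AbelianVariety ℂ) (φ : A ⟶ A) (d : ℕ) {h : complexBetti A.X 2}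

/-- **TABLE X ROW 9 (`End⁰ = K` EXACTLY), EVERY MEMBER, binders `hW, hE2, hh, hnd, hφQ` ONLY** — `census_weilType_endK` with the
domain datum `¬ 𝒞 A` discharged from `finrank_ℚ End⁰(A) = 2` (`A` simple, not of CM type). Conclusion `(dim A = 6 ∧ ¬ 𝒞 A) ∧`
X2-at-`A` `∧` X1-at-`A`. HC NOT proved. [cite: vanGeemen1994HodgeAV, 6.9, Thm. 6.11 and Thm. 6.12] [cite: Milne1999, §2 p. 54]
[cite: MoonenZarhin1999LowDim, (2.3) and §3 (3.1)] [cite: Milne1999LefschetzClasses, Thm. 3.2 and Cor. 4.5] -/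
theorem census_weilType_endK' (hW : IsWeilType A φ 3 d) (hE2 : Module.finrank ℚ A.endAlgebra = 2)
    (hh : h ∈ VanGeemen1994.hodgeClassSpan A.dim A.X 1)
    (hnd : ∀ x : complexBetti A.X 1, (∀ y, polarizationPairingOne A.X h (A.dim - 1) x y = 0) → x = 0)
    (hφQ : ∀ x y, polarizationPairingOne A.X h (A.dim - 1) (pullbackOne A φ x) (pullbackOne A φ y) =
      (d : ℂ) • polarizationPairingOne A.X h (A.dim - 1) x y) :
    (A.dim = 6 ∧ ¬ (IsOfCMType A ∨ ProdCMCell IsQuarticFieldTypeIVFourfold (fun Z ↦ Z.dim = 2) A)) ∧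
    (∀ c : complexBetti A.X (2 * 2), IsRationalClass c → IsOfHodgeType A.dim A.X (2 * 2) 2 2 c →
      c ∈ divisorClassesSpan A.X A.dim 2 ⊔ Submodule.span ℂ {w' : complexBetti A.X (2 * 2) |
        ∃ (C : AbelianVariety ℂ) (g : A.X ⟶ C.X) (w : complexBetti C.X (2 * 2)), C.dim < A.dim ∧
          IsRationalClass w ∧ IsOfHodgeType C.dim C.X (2 * 2) 2 2 w ∧ w' = complexBetti.map g (2 * 2) w}) ∧
    (∀ c : complexBetti A.X (2 * 3), IsRationalClass c → IsOfHodgeType A.dim A.X (2 * 3) 3 3 c →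
      c ∈ divisorClassesSpan A.X A.dim 3 ⊔ Submodule.span ℂ {w' : complexBetti A.X (2 * 3) |
          ∃ (a : complexBetti A.X (2 * 2)) (b : complexBetti A.X (2 * 1)),
            IsRationalClass a ∧ IsOfHodgeType A.dim A.X (2 * 2) 2 2 a ∧ IsRationalClass b ∧
            IsOfHodgeType A.dim A.X (2 * 1) 1 1 b ∧ w' = cupProduct (two_mul_add_two_mul 2 1) a b} ⊔
        Submodule.span ℂ {w' : complexBetti A.X (2 * 3) |
          ∃ (C : AbelianVariety ℂ) (g : A.X ⟶ C.X) (w : complexBetti C.X (2 * 3)), C.dim < A.dim ∧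
            IsRationalClass w ∧ IsOfHodgeType C.dim C.X (2 * 3) 3 3 w ∧ w' = complexBetti.map g (2 * 3) w} ⊔
        Submodule.span ℂ {w' : complexBetti A.X (2 * 3) |
          ∃ (B' : AbelianVariety ℂ) (g : A.X ⟶ B'.X) (d : ℕ) (ψ : B' ⟶ B') (w : complexBetti B'.X (2 * 3)),
            B'.dim = 6 ∧ 0 < d ∧ ψ ≫ ψ = -(d • 𝟙 B') ∧ IsRationalClass w ∧
            IsOfHodgeType B'.dim B'.X (2 * 3) 3 3 w ∧ w ∈ weilClassesOf B' ψ 3 d ∧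
            w' = complexBetti.map g (2 * 3) w}) := by
  haveI : HodgeTensorFacts.{0, 0} := hodgeTensorFacts_holds
  exact census_weilType_endK A φ d hW hE2
    (not_residueClass_of_isSimple_of_not_isOfCMType
      (isSimple_of_finrank_endAlgebra_eq_two (by rw [hW.dim_eq]; norm_num) hW.d_pos hW.sq_eq hE2)
      (not_isOfCMType_of_finrank_endAlgebra_eq_two (by rw [hW.dim_eq]; norm_num) hW.d_pos hW.sq_eq hE2))
    hh hnd hφQ

/-- **Row 9, every member, on the whole ISOGENY CLASS**, binders `hW, hE2, hh, hnd, hφQ, hA'A` only.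
[cite: vanGeemen1994HodgeAV, Lemma 3.7 and Thm. 6.12] [cite: Milne1999, §2 p. 54] -/
theorem census_weilType_endK'_of_isIsogenous {A' : AbelianVariety ℂ} (hW : IsWeilType A φ 3 d)
    (hE2 : Module.finrank ℚ A.endAlgebra = 2)
    (hh : h ∈ VanGeemen1994.hodgeClassSpan A.dim A.X 1)
    (hnd : ∀ x : complexBetti A.X 1, (∀ y, polarizationPairingOne A.X h (A.dim - 1) x y = 0) → x = 0)
    (hφQ : ∀ x y, polarizationPairingOne A.X h (A.dim - 1) (pullbackOne A φ x) (pullbackOne A φ y) =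
      (d : ℂ) • polarizationPairingOne A.X h (A.dim - 1) x y)
    (hA'A : IsIsogenous A' A) :
    (A'.dim = 6 ∧ ¬ (IsOfCMType A' ∨ ProdCMCell IsQuarticFieldTypeIVFourfold (fun Z ↦ Z.dim = 2) A')) ∧
    (∀ c : complexBetti A'.X (2 * 2), IsRationalClass c → IsOfHodgeType A'.dim A'.X (2 * 2) 2 2 c →
      c ∈ divisorClassesSpan A'.X A'.dim 2 ⊔ Submodule.span ℂ {w' : complexBetti A'.X (2 * 2) |
        ∃ (C : AbelianVariety ℂ) (g : A'.X ⟶ C.X) (w : complexBetti C.X (2 * 2)), C.dim < A'.dim ∧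
          IsRationalClass w ∧ IsOfHodgeType C.dim C.X (2 * 2) 2 2 w ∧ w' = complexBetti.map g (2 * 2) w}) ∧
    (∀ c : complexBetti A'.X (2 * 3), IsRationalClass c → IsOfHodgeType A'.dim A'.X (2 * 3) 3 3 c →
      c ∈ divisorClassesSpan A'.X A'.dim 3 ⊔ Submodule.span ℂ {w' : complexBetti A'.X (2 * 3) |
          ∃ (a : complexBetti A'.X (2 * 2)) (b : complexBetti A'.X (2 * 1)),
            IsRationalClass a ∧ IsOfHodgeType A'.dim A'.X (2 * 2) 2 2 a ∧ IsRationalClass b ∧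
            IsOfHodgeType A'.dim A'.X (2 * 1) 1 1 b ∧ w' = cupProduct (two_mul_add_two_mul 2 1) a b} ⊔
        Submodule.span ℂ {w' : complexBetti A'.X (2 * 3) |
          ∃ (C : AbelianVariety ℂ) (g : A'.X ⟶ C.X) (w : complexBetti C.X (2 * 3)), C.dim < A'.dim ∧
            IsRationalClass w ∧ IsOfHodgeType C.dim C.X (2 * 3) 3 3 w ∧ w' = complexBetti.map g (2 * 3) w} ⊔
        Submodule.span ℂ {w' : complexBetti A'.X (2 * 3) |
          ∃ (B' : AbelianVariety ℂ) (g : A'.X ⟶ B'.X) (d : ℕ) (ψ : B' ⟶ B') (w : complexBetti B'.X (2 * 3)),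
            B'.dim = 6 ∧ 0 < d ∧ ψ ≫ ψ = -(d • 𝟙 B') ∧ IsRationalClass w ∧
            IsOfHodgeType B'.dim B'.X (2 * 3) 3 3 w ∧ w ∈ weilClassesOf B' ψ 3 d ∧
            w' = complexBetti.map g (2 * 3) w}) := by
  haveI : HodgeTensorFacts.{0, 0} := hodgeTensorFacts_holds
  exact census_weilType_endK_of_isIsogenous A φ d hW hE2
    (not_residueClass_of_isSimple_of_not_isOfCMType
      (isSimple_of_finrank_endAlgebra_eq_two (by rw [hW.dim_eq]; norm_num) hW.d_pos hW.sq_eq hE2)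
      (not_isOfCMType_of_finrank_endAlgebra_eq_two (by rw [hW.dim_eq]; norm_num) hW.d_pos hW.sq_eq hE2))
    hh hnd hφQ hA'A

end Summit.HodgeConjecture.HodgeConjecture.TableX.WeilLieRows
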